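import Mathlib.LinearAlgebra.Matrix.Transvection
import Mathlib.LinearAlgebra.Matrix.SchurComplement
import Mathlib.RingTheory.MvPolynomial.Homogeneous
import Literature.Computability.AlgebraicComplexity.HessianRank
import Literature.Computability.AlgebraicComplexity.HessianAtOrigin
import Literature.Analysis.Matrix.DetAddDiagonalMinors
import HarnessLib

/-!
# Mignon–Ressayre 2004, §2: the determinantal complexity of quadratic forms (Theorem 1, Lemma 2.1)

Topic `Literature/Computability/AlgebraicComplexity` (cell val-lit, typer seat t10, row MR2004-A;
companion of `MR04HessianExactRank.lean`). Source: T. Mignon, N. Ressayre, *A quadratic bound for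
the determinant and permanent problem*, Int. Math. Res. Not. 2004:79, 4241–4253 (key
`MignonRessayre2004`; journal text not held, acq-00163 cite-only), read in the AUTHORS' PREPRINT
`permdet.pdf` as decoded by the val-lit literature seat (`pub/val-lit/lit/MR2004/txt`, PREPRINT
numbering and page/line locators `p. N L n` of `ALL.txt`). Everything in this file is PROVED; the
only definitions are the two split normal forms `splitQuadric`, `splitQuadricOdd`. Honest framing:
a classical small-rank computation, formalised; `VP ≠ VNP` is not proved and nothing here is
progress on it.

## The printed statements

* **Lemma 2.1** (p. 4 L153–156): "Let `n ≥ 2` be an integer and `A : V → M_n(𝐤)` be an affine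
  map. We assume that `det ∘ A` is a quadratic form on `V` and denote by `r` its rank. If `n = 2`
  then `r ≤ 4` and if `n ≥ 3` then `r ≤ 2(n - 1)`."  Proof (p. 4 L157 – p. 5 L189): normalise
  `M = A(0)` (singular, as `P(0) = 0`) to `diag(0_d, I)`, so that all entries of `A` are linear
  except the last diagonal ones; degree counting in `det A = Σ_σ sgn σ ∏ A_{iσ(i)}` gives `d ≤ 2`,
  `P = A₁₁A₂₂ - A₂₁A₁₂` if `d = 2` ("and so that `r ≤ 4`"), and `A₁₁ = 0`,
  `P = Σ_{i ≥ 2} A_{1i}A_{i1}` if `d = 1` ("and so `r ≤ 2(n-1)`").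
* **Theorem 1** (§2 statement, p. 4 L147–151; `𝐤` algebraically closed, p. 2 L62): "Let `P` be a
  non zero quadratic form on `V`. Let `r` denote the rank of `P`. Then: `𝒟c(P) = 2` if `r ≤ 4`;
  `⌈r/2⌉ + 1` else."  Proof (p. 5 L190 – p. 6 L12): `𝒟c ≥ deg = 2`; for `r ≤ 4` explicit `2 × 2`
  matrices; for `r ≥ 5` the lower bound is Lemma 2.1 ("Lemma 2.1 shows that `𝒟c(P) ≥ r/2 + 1`",
  p. 5 L197) and the upper bound is the bordered `(d+1) × (d+1)` matrix
  `[[0, x₁ … x_d], [-y₁, 1, 0 …], …, [-y_d, 0, …, 1]]` with determinant `Σ xᵢyᵢ` (`r = 2d`), resp.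
  the `(d+2) × (d+2)` one for `Σ xᵢyᵢ + z²` (`r = 2d+1`: "So, `𝒟c(P) ≤ d + 2 = ⌈r/2 + 1⌉`").
  NB. The preprint's INTRODUCTION (p. 2 L62–69) prints the value as `⌈(r+1)/2⌉`, which differs
  from the §2 statement for odd `r ≥ 5` and is not what the proof gives; Alper–Bogart–Velasco 2017
  (arXiv:1505.02205v1, p. 3) quote "`⌈(r+1)/2⌉` for `r ≥ 4` and `2` otherwise [MR04, Thm. 1.4]",
  which is false at `r = 4` (`dc(x₁y₁ + x₂y₂) = 2`, `determinantalComplexity_splitQuadric_two`).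
  The §2 form is the one proved below.  What the IMRN print says is not verified here.

## What is proved (tree vocabulary: `IsAffineDetRepr`, `HasDetRepr`, `determinantalComplexity` of
`DeterminantalComplexity.lean`; the rank `r` of a quadratic form `P` is expressed as
`rank (hess0 P)`, `hess0` = the Hessian at the origin of `HessianAtOrigin.lean`, i.e. the matrix of
the polar bilinear form — the rank of the form whenever `2 ≠ 0` in `k`)

* `mignonRessayre2004_lemma_2_1` — Lemma 2.1 over ANY field in the uniform shape
  `rank H₀(P) ≤ 2 · max(2, n - 1)` for `P = det A`, `A` affine `n × n`, `P` homogeneous of degree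
  `2`; the two printed clauses `…_two` (`n = 2 ⇒ r ≤ 4`) and `…_three_le` (`n ≥ 3 ⇒ r ≤ 2(n-1)`);
  and the structural statement behind it, `MR04Quadric.exists_eq_sum_mul_of_isAffineDetRepr`:
  such a `P` is a sum of at most `max(2, n-1)` products of two linear forms.  The proof follows the
  printed one: the constant part `A(0)` is brought to a DIAGONAL matrix by products of
  transvections (Mathlib's `Matrix.Pivot.exists_list_transvec_mul_mul_list_transvec_eq_diagonal`;
  determinant `1`, so `P` is unchanged — the printed `diag(0, I)` is not needed), the expansion
  `det(L + diag d) = Σ_S (∏_{i∉S} dᵢ) det L_S` (`Literature.Analysis.Matrix.det_add_diagonal_eq_sum_minors`)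
  replaces the permutation-sum bookkeeping, and its homogeneous components of degrees `1` and `2`
  at an index `a` with `d_a = 0` give exactly the printed dichotomy (`A_{aa}`'s linear part
  vanishes unless a second `d_b` vanishes).
* `mignonRessayre2004_thm_1_lower` — the lower half of Theorem 1 for EVERY quadratic form over
  every field: `r ≥ 5 ⇒ r + 2 ≤ 2 · dc(P)` (`dc(P) ≥ ⌈r/2⌉ + 1`).
* `MR04Quadric.hasDetRepr_sum_mul` — the bordered matrix: `Σ_{i∈ι} uᵢvᵢ` has an affine
  determinantal representation of size `|ι| + 1` for affine `uᵢ, vᵢ`.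
* `mignonRessayre2004_thm_1_even` / `…_odd` — Theorem 1 on the split normal forms
  `splitQuadric k d = Σ_{i<d} xᵢyᵢ` (`dc = d + 1` for `d ≥ 3`, every field) and
  `splitQuadricOdd k d = Σ_{i<d} xᵢyᵢ + z²` (`dc = d + 2` for `d ≥ 2`, every field with `2 ≠ 0`),
  with `rank H₀ = 2d`, `2d + 1` computed from an explicit inverse of the Hessian; and the `r ≤ 4`
  table `determinantalComplexity_splitQuadricOdd_zero/…splitQuadric_one/…splitQuadricOdd_one/
  …splitQuadric_two` (`dc = 2` for `z²`, `xy`, `xy + z²`, `x₁y₁ + x₂y₂`, every field).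
  Over an algebraically closed field of characteristic `≠ 2` every quadratic form of rank `r` is
  `GL`-equivalent to the split form of rank `r`, and `dc`, `r` are `GL`-invariants, so these are the
  printed statement; the reduction itself is not threaded here:
  -- TODO(general form): arbitrary quadratic form ↦ split normal form (Mathlib
  -- `QuadraticForm.equivalent_weightedSumSquares` + invariance of `HasDetRepr` under linear
  -- substitutions, cf. `HasDetRepr.of_isProjection_holds`).
* Contrast: Landsberg–Ressayre 2017, Prop. 2.11 (`lr_prop_2_11_le/_ge`,
  `LR17EquivariantRepresentations.lean`, seat t12) is about the EQUIVARIANT determinantal complexity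
  of a nondegenerate quadric in `M` variables (`edc = M + 1`), a different quantity; its witness
  `[[I, Sx], [-xᵀ, 0]]` (`LR17Quadric.det_fromBlocks_eq`) is the symmetric case of the bordered
  matrix used here.

## References

* T. Mignon, N. Ressayre, *A quadratic bound for the determinant and permanent problem*, IMRN
  2004:79, 4241–4253, doi:10.1155/S1073792804142566 (key `MignonRessayre2004`); authors' preprint
  decoded in `pub/val-lit/lit/MR2004/txt` (§2 = p. 3–6: Prop. 2.1, Theorem 1, Lemma 2.1).
* J. Alper, T. Bogart, M. Velasco, *A lower bound for the determinantal complexity of a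
  hypersurface*, Found. Comput. Math. 17 (2017), arXiv:1505.02205, p. 3 (the quotation of MR04's
  quadric theorem; key `AlperBogartVelasco2017`).
* J. M. Landsberg, N. Ressayre, *Permanent v. determinant: an exponential lower bound assuming
  symmetry and a potential path towards Valiant's conjecture*, Differential Geom. Appl. 55 (2017),
  Prop. 2.11 (key `LandsbergRessayre2017`).
-/

noncomputable section

open MvPolynomial Matrix Finset

namespace Literature.Computability.AlgebraicComplexity

namespace MR04Quadric

variable {k : Type*} [Field k] {σ : Type*}

/-! ### Tools -/

/-- A polynomial of total degree `≤ 1` without constant term is a linear form (homogeneous of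
degree `1`). [folklore] -/
private theorem isHomogeneous_one_of_totalDegree_le_one {f : MvPolynomial σ k}
    (h1 : f.totalDegree ≤ 1) (h0 : constantCoeff f = 0) : f.IsHomogeneous 1 := by
  have key : homogeneousComponent 1 f = f := by
    ext d
    rw [coeff_homogeneousComponent]
    split_ifs with hd
    · rfl
    · symm
      by_cases hd0 : d = 0
      · subst hd0
        exact h0
      · apply coeff_eq_zero_of_totalDegree_lt
        have hpos : Finsupp.degree d ≠ 0 := fun h => hd0 ((Finsupp.degree_eq_zero_iff d).1 h)
        have hdeg : (Finsupp.degree d : ℕ) = ∑ i ∈ d.support, d i := rfl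
        omega
  rw [← key]
  exact homogeneousComponent_isHomogeneous 1 f

/-- A determinant of linear forms is homogeneous of degree the size of the matrix (the same
eight-line argument as `isHomogeneous_det_of_linear` in `ABV17SingularLocusBound.lean`, not
imported here). [folklore] -/
private theorem isHomogeneous_det_of_isHomogeneous_one {ι : Type*} [Fintype ι] [DecidableEq ι]
    (A : Matrix ι ι (MvPolynomial σ k)) (hA : ∀ i j, (A i j).IsHomogeneous 1) :
    A.det.IsHomogeneous (Fintype.card ι) := by
  rw [Matrix.det_apply]
  refine IsHomogeneous.sum _ _ _ fun π _ => ?_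
  have := IsHomogeneous.prod (φ := fun i : ι => A (π i) i) univ (fun _ => 1) fun i _ => hA (π i) i
  rw [Units.smul_def, zsmul_eq_mul, ← map_intCast (C : k →+* MvPolynomial σ k)]
  simp only [sum_const, smul_eq_mul, mul_one, card_univ] at this
  simpa only [zero_add] using (isHomogeneous_C _ _).mul this

/-- The `2 × 2` principal minor on `{a, b}`. [folklore] -/
private theorem det_submatrix_pair {R : Type*} [CommRing R] {n : ℕ} (L : Matrix (Fin n) (Fin n) R)
    {a b : Fin n} (hab : a ≠ b) :
    (L.submatrix ((↑) : ({a, b} : Finset (Fin n)) → Fin n)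
        ((↑) : ({a, b} : Finset (Fin n)) → Fin n)).det
      = L a a * L b b - L a b * L b a := by
  classical
  let e : Fin 2 → ({a, b} : Finset (Fin n)) :=
    ![⟨a, by simp⟩, ⟨b, by simp⟩]
  have he : Function.Bijective e := by
    constructor
    · intro i j h
      fin_cases i <;> fin_cases j
      · rfl
      · exact absurd (congrArg Subtype.val h) hab
      · exact absurd (congrArg Subtype.val h).symm hab
      · rfl
    · rintro ⟨x, hx⟩
      have hx' : x = a ∨ x = b := by simpa using hx
      rcases hx' with rfl | rfl
      · exact ⟨0, rfl⟩
      · exact ⟨1, rfl⟩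
  rw [← det_submatrix_equiv_self (Equiv.ofBijective e he), det_fin_two]
  rfl

/-- `rank H₀(f g) ≤ 2` when `f(0) = g(0) = 0`: `H₀(fg) = ∇f ∇gᵀ + ∇g ∇fᵀ` (`hess0_mul`). [folklore] -/
private theorem rank_hess0_mul_le [Fintype σ] {f g : MvPolynomial σ k} (hf : constantCoeff f = 0)
    (hg : constantCoeff g = 0) : (hess0 (f * g)).rank ≤ 2 := by
  rw [hess0_mul, hf, hg, zero_smul, zero_smul, zero_add, zero_add]
  exact (rank_add_le _ _).trans (add_le_add (rank_vecMulVec_le _ _) (rank_vecMulVec_le _ _))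

/-- `rank H₀(Σ_{i ∈ s} fᵢ gᵢ) ≤ 2 |s|` when all `fᵢ(0) = gᵢ(0) = 0`. [folklore] -/
private theorem rank_hess0_sum_mul_le [Fintype σ] {ι : Type*} (s : Finset ι)
    {f g : ι → MvPolynomial σ k} (hf : ∀ i, constantCoeff (f i) = 0)
    (hg : ∀ i, constantCoeff (g i) = 0) :
    (hess0 (∑ i ∈ s, f i * g i)).rank ≤ 2 * s.card := by
  classical
  induction s using Finset.induction_on with
  | empty => simp
  | insert a s ha ih =>
    rw [Finset.sum_insert ha, map_add, Finset.card_insert_of_notMem ha]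
    calc _ ≤ (hess0 (f a * g a)).rank + (hess0 (∑ i ∈ s, f i * g i)).rank := rank_add_le _ _
      _ ≤ 2 + 2 * s.card := add_le_add (rank_hess0_mul_le (hf a) (hg a)) ih
      _ = 2 * (s.card + 1) := by ring

/-! ### Lemma 2.1: the structure of a quadratic form `det A`, `A` affine of size `n` -/

/-- Normalisation step of the proof of Lemma 2.1 (p4 L157–L162: "There exists two invertible
matrices `U` and `W` such that `U M W = diag(0, I)` … we may assume that `M = M̃`"): replacing `A`
by `U A W` for products of transvections `U, W` (determinant `1`) keeps `det A = P` and the entries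
affine, and makes the constant part `A(0)` diagonal. [cite: MignonRessayre2004, Lemma 2.1 (preprint p. 4)] -/
theorem exists_isAffineDetRepr_map_constantCoeff_eq_diagonal {n : ℕ} {P : MvPolynomial σ k}
    {A : Matrix (Fin n) (Fin n) (MvPolynomial σ k)} (hA : IsAffineDetRepr P A) :
    ∃ (B : Matrix (Fin n) (Fin n) (MvPolynomial σ k)) (D : Fin n → k),
      IsAffineDetRepr P B ∧ B.map constantCoeff = diagonal D := by
  classical
  obtain ⟨hdeg, hdet⟩ := hA
  obtain ⟨L, L', D, hD⟩ :=
    Matrix.Pivot.exists_list_transvec_mul_mul_list_transvec_eq_diagonal (A.map constantCoeff)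
  refine ⟨((L.map Matrix.TransvectionStruct.toMatrix).prod).map C * A *
      ((L'.map Matrix.TransvectionStruct.toMatrix).prod).map C, D, ⟨fun i j => ?_, ?_⟩, ?_⟩
  · -- affine entries
    simp only [Matrix.mul_apply]
    refine totalDegree_finsetSum_le fun x _ => (totalDegree_mul _ _).trans ?_
    rw [Matrix.map_apply, totalDegree_C, add_zero]
    refine totalDegree_finsetSum_le fun y _ => (totalDegree_mul _ _).trans ?_
    rw [Matrix.map_apply, totalDegree_C, zero_add]
    exact hdeg y x
  · -- determinant
    rw [det_mul, det_mul, ← RingHom.mapMatrix_apply, ← RingHom.map_det, ← RingHom.mapMatrix_apply,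
      ← RingHom.map_det, Matrix.TransvectionStruct.det_toMatrix_prod,
      Matrix.TransvectionStruct.det_toMatrix_prod, C_1, one_mul, mul_one, hdet]
  · -- constant part
    have h1 : ∀ U : Matrix (Fin n) (Fin n) k,
        (U.map (C : k → MvPolynomial σ k)).map (constantCoeff : MvPolynomial σ k → k) = U := by
      intro U
      ext i j
      simp
    rw [Matrix.map_mul, Matrix.map_mul, h1, h1]
    exact hD

/-- **Mignon–Ressayre 2004, Lemma 2.1 — structural form** (preprint p. 4 L153–156, proof p. 4
L157 – p. 5 L189: "one easily deduces that `P = A₁₁A₂₂ - A₂₁A₁₂` and so that `r ≤ 4`" /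
"We obtain `P = Σ_{i=2}^{n} A_{1i} A_{i1}`, and so `r ≤ 2(n-1)`"). Over any field: if
`P = det A` for an `n × n` matrix `A` of affine linear forms and `P` is a quadratic form
(homogeneous of degree `2`), then `P` is a sum of at most `max(2, n - 1)` products of two linear
forms. Proof as printed, with the normal form of `A(0)` taken diagonal (transvections) and the
expansion `det(L + diag d) = Σ_S (∏_{i∉S} dᵢ) det L_S` (`det_add_diagonal_eq_sum_minors`) read in
degrees `1` and `2` at an index `a` with `d_a = 0`. [cite: MignonRessayre2004, Lemma 2.1 (preprint p. 4)] -/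
theorem exists_eq_sum_mul_of_isAffineDetRepr {n : ℕ} {P : MvPolynomial σ k}
    {A : Matrix (Fin n) (Fin n) (MvPolynomial σ k)} (hA : IsAffineDetRepr P A)
    (hP : P.IsHomogeneous 2) :
    ∃ (s : Finset (Fin n)) (f g : Fin n → MvPolynomial σ k), s.card ≤ max 2 (n - 1) ∧
      (∀ i, (f i).totalDegree ≤ 1 ∧ constantCoeff (f i) = 0) ∧
      (∀ i, (g i).totalDegree ≤ 1 ∧ constantCoeff (g i) = 0) ∧ P = ∑ i ∈ s, f i * g i := by
  classical
  obtain ⟨B, D, ⟨hdeg, hdet⟩, hBD⟩ := exists_isAffineDetRepr_map_constantCoeff_eq_diagonal hA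
  clear hA A
  -- the linear part `L` of `B = L + diag D`
  set L : Matrix (Fin n) (Fin n) (MvPolynomial σ k) := B - (diagonal D).map C with hL
  have hL0 : ∀ i j, constantCoeff (L i j) = 0 := by
    intro i j
    have h := congr_fun (congr_fun hBD i) j
    rw [Matrix.map_apply] at h
    rw [hL, Matrix.sub_apply, map_sub, h, Matrix.map_apply, constantCoeff_C]
    exact sub_self _
  have hL1 : ∀ i j, (L i j).totalDegree ≤ 1 := by
    intro i j
    rw [hL, Matrix.sub_apply, Matrix.map_apply]
    refine (totalDegree_sub _ _).trans (max_le (hdeg i j) ?_)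
    rw [totalDegree_C]
    exact zero_le_one
  have hLh : ∀ i j, (L i j).IsHomogeneous 1 := fun i j =>
    isHomogeneous_one_of_totalDegree_le_one (hL1 i j) (hL0 i j)
  have hBL : B = L + diagonal fun i => C (D i) := by
    rw [hL, Matrix.diagonal_map (map_zero C), sub_add_cancel]
  -- abbreviations: coefficient `c S` and minor `m S`
  set c : Finset (Fin n) → MvPolynomial σ k := fun S => ∏ i ∈ Sᶜ, C (D i) with hc
  set m : Finset (Fin n) → MvPolynomial σ k := fun S =>
    (L.submatrix ((↑) : S → Fin n) ((↑) : S → Fin n)).det with hm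
  have hcC : ∀ S, c S = C (∏ i ∈ Sᶜ, D i) := fun S => by rw [hc, map_prod]
  -- the principal-minor expansion, and homogeneity of its terms
  have hexp : P = ∑ S : Finset (Fin n), c S * m S := by
    rw [← hdet, hBL]
    exact Literature.Analysis.Matrix.det_add_diagonal_eq_sum_minors L fun i => C (D i)
  have hmin : ∀ S : Finset (Fin n), (c S * m S).IsHomogeneous S.card := by
    intro S
    have h := isHomogeneous_det_of_isHomogeneous_one
      (L.submatrix ((↑) : S → Fin n) ((↑) : S → Fin n)) fun i j => hLh _ _
    rw [Fintype.card_coe] at h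
    rw [hcC]
    exact h.C_mul _
  have hcomp : ∀ j, homogeneousComponent j P =
      ∑ S : Finset (Fin n), if j = S.card then c S * m S else 0 := by
    intro j
    rw [hexp, map_sum]
    exact Finset.sum_congr rfl fun S _ => homogeneousComponent_of_mem (hmin S)
  -- an index `a` with `D a = 0` (`det A(0) = P(0) = 0`)
  have hdetD : ∏ i, D i = 0 := by
    have h : (B.map constantCoeff).det = 0 := by
      rw [← RingHom.mapMatrix_apply, ← RingHom.map_det, hdet]
      exact hP.coeff_eq_zero (by simp)
    rwa [hBD, det_diagonal] at h
  obtain ⟨a, -, ha⟩ := Finset.prod_eq_zero_iff.1 hdetD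
  have hca : ∀ S : Finset (Fin n), a ∉ S → c S = 0 := fun S hS =>
    Finset.prod_eq_zero (Finset.mem_compl.2 hS) (by rw [ha, map_zero])
  -- degree 1: `c {a} · L a a = 0`
  have h1 : C (∏ i ∈ ({a}ᶜ : Finset (Fin n)), D i) * L a a = 0 := by
    have h := hcomp 1
    rw [homogeneousComponent_of_mem hP, if_neg (by norm_num : (1 : ℕ) ≠ 2),
      Finset.sum_eq_single {a}] at h
    · rw [card_singleton, if_pos rfl, hcC] at h
      have hma : m {a} = L a a := by
        simp only [hm]
        rw [Matrix.det_eq_elem_of_card_eq_one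
          (A := L.submatrix ((↑) : ({a} : Finset (Fin n)) → Fin n)
            ((↑) : ({a} : Finset (Fin n)) → Fin n)) (by simp) ⟨a, by simp⟩]
        rfl
      rw [hma] at h
      exact h.symm
    · intro S _ hS
      split_ifs with h1S
      · obtain ⟨b, rfl⟩ := Finset.card_eq_one.1 h1S.symm
        have hab : a ∉ ({b} : Finset (Fin n)) := by
          rw [mem_singleton]
          rintro rfl
          exact hS rfl
        rw [hca _ hab, zero_mul]
      · rfl
    · intro h
      exact absurd (Finset.mem_univ _) h
  -- degree 2: `P = Σ_{b ≠ a} c {a,b} · (L a a L b b - L a b L b a)`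
  have h2 : P = ∑ b ∈ univ.erase a,
      C (∏ i ∈ ({a, b}ᶜ : Finset (Fin n)), D i) * (L a a * L b b - L a b * L b a) := by
    have h := hcomp 2
    rw [homogeneousComponent_of_mem hP, if_pos rfl] at h
    rw [h]
    have hinj : ∀ x ∈ univ.erase a, ∀ y ∈ univ.erase a,
        ({a, x} : Finset (Fin n)) = {a, y} → x = y := by
      intro x hx y _ hxy
      have hx' : x ∈ ({a, y} : Finset (Fin n)) := by rw [← hxy]; simp
      rcases Finset.mem_insert.1 hx' with h | h
      · exact absurd h (Finset.mem_erase.1 hx).1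
      · exact Finset.mem_singleton.1 h
    calc ∑ S : Finset (Fin n), (if 2 = S.card then c S * m S else 0)
        = ∑ S ∈ (univ.erase a).image fun b => ({a, b} : Finset (Fin n)),
            (if 2 = S.card then c S * m S else 0) := by
          symm
          apply Finset.sum_subset (Finset.subset_univ _)
          intro S _ hS
          split_ifs with h2S
          · obtain ⟨x, y, hxy, rfl⟩ := Finset.card_eq_two.1 h2S.symm
            have haS : a ∉ ({x, y} : Finset (Fin n)) := by
              intro haS
              apply hS
              rw [Finset.mem_image]
              rcases Finset.mem_insert.1 haS with h | h
              · subst h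
                exact ⟨y, Finset.mem_erase.2 ⟨hxy.symm, Finset.mem_univ _⟩, rfl⟩
              · rw [Finset.mem_singleton] at h
                subst h
                exact ⟨x, Finset.mem_erase.2 ⟨hxy, Finset.mem_univ _⟩, Finset.pair_comm _ _⟩
            rw [hca _ haS, zero_mul]
          · rfl
      _ = ∑ b ∈ univ.erase a, (if 2 = ({a, b} : Finset (Fin n)).card then c {a, b} * m {a, b}
            else 0) := Finset.sum_image hinj
      _ = _ := by
          refine Finset.sum_congr rfl fun b hb => ?_
          have hab : a ≠ b := (Ne.symm (Finset.mem_erase.1 hb).1)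
          rw [if_pos (Finset.card_pair_eq_two_iff.2 hab).symm, hcC, hm]
          exact congrArg _ (det_submatrix_pair L hab)
  -- case analysis on a second zero of `D`
  by_cases hcz : (∏ i ∈ ({a}ᶜ : Finset (Fin n)), D i) = 0
  · -- (ii) `D b₀ = 0` for some `b₀ ≠ a`: only `b = b₀` survives, two products
    obtain ⟨b₀, hb₀, hDb₀⟩ := Finset.prod_eq_zero_iff.1 hcz
    have hb₀a : b₀ ≠ a := by simpa using hb₀
    have hcb : ∀ b, b ≠ b₀ → (∏ i ∈ ({a, b}ᶜ : Finset (Fin n)), D i) = 0 := fun b hbb =>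
      Finset.prod_eq_zero (by simp [hb₀a, Ne.symm hbb]) hDb₀
    set c₀ : k := ∏ i ∈ ({a, b₀}ᶜ : Finset (Fin n)), D i with hc₀
    have hP2 : P = C c₀ * (L a a * L b₀ b₀ - L a b₀ * L b₀ a) := by
      rw [h2, Finset.sum_eq_single b₀]
      · intro b _ hbb
        rw [hcb b hbb, map_zero, zero_mul]
      · intro h
        exact absurd (Finset.mem_erase.2 ⟨hb₀a, Finset.mem_univ _⟩) h
    refine ⟨{a, b₀}, fun i => if i = a then C c₀ * L a a else -(C c₀ * L a b₀),
      fun i => if i = a then L b₀ b₀ else L b₀ a, ?_, ?_, ?_, ?_⟩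
    · rw [Finset.card_pair_eq_two_iff.2 hb₀a.symm]
      exact le_max_left _ _
    · intro i
      dsimp only
      split_ifs
      · refine ⟨(totalDegree_mul _ _).trans ?_, by rw [map_mul, hL0, mul_zero]⟩
        rw [totalDegree_C, zero_add]
        exact hL1 _ _
      · refine ⟨?_, by rw [map_neg, map_mul, hL0, mul_zero, neg_zero]⟩
        rw [totalDegree_neg]
        refine (totalDegree_mul _ _).trans ?_
        rw [totalDegree_C, zero_add]
        exact hL1 _ _
    · intro i
      dsimp only
      split_ifs
      · exact ⟨hL1 _ _, hL0 _ _⟩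
      · exact ⟨hL1 _ _, hL0 _ _⟩
    · rw [Finset.sum_pair hb₀a.symm]
      dsimp only
      rw [if_pos rfl, if_pos rfl, if_neg hb₀a, if_neg hb₀a, hP2]
      ring
  · -- (i) all other `D b ≠ 0`: then `L a a = 0` and `n - 1` products remain
    have hLaa : L a a = 0 := by
      rcases mul_eq_zero.1 h1 with h | h
      · exact absurd (C_eq_zero.1 h) hcz
      · exact h
    refine ⟨univ.erase a, fun b => -(C (∏ i ∈ ({a, b}ᶜ : Finset (Fin n)), D i) * L a b),
      fun b => L b a, ?_, ?_, ?_, ?_⟩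
    · rw [Finset.card_erase_of_mem (Finset.mem_univ a), Finset.card_univ, Fintype.card_fin]
      exact le_max_right _ _
    · intro b
      dsimp only
      refine ⟨?_, by rw [map_neg, map_mul, hL0, mul_zero, neg_zero]⟩
      rw [totalDegree_neg]
      refine (totalDegree_mul _ _).trans ?_
      rw [totalDegree_C, zero_add]
      exact hL1 _ _
    · exact fun b => ⟨hL1 _ _, hL0 _ _⟩
    · rw [h2]
      refine Finset.sum_congr rfl fun b _ => ?_
      dsimp only
      rw [hLaa]
      ring

end MR04Quadric

open MR04Quadric in
/-- **Mignon–Ressayre 2004, Lemma 2.1** (preprint p. 4 L153–156: "Let `n ≥ 2` be an integer and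
`A : V → M_n(𝐤)` be an affine map. We assume that `det ∘ A` is a quadratic form on `V` and denote by
`r` its rank. If `n = 2` then `r ≤ 4` and if `n ≥ 3` then `r ≤ 2(n - 1)`."), over ANY field, with
the rank of the quadratic form `P` expressed as the rank of its Hessian at the origin `hess0 P`
(twice the Gram matrix; this is the rank of the form whenever `2 ≠ 0` in `k`): in the uniform
shape `rank H₀(P) ≤ 2 · max(2, n - 1)`. [cite: MignonRessayre2004, Lemma 2.1 (preprint p. 4)] -/
theorem mignonRessayre2004_lemma_2_1 {k : Type*} [Field k] {σ : Type*} [Fintype σ] {n : ℕ}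
    {P : MvPolynomial σ k} {A : Matrix (Fin n) (Fin n) (MvPolynomial σ k)}
    (hA : IsAffineDetRepr P A) (hP : P.IsHomogeneous 2) :
    (hess0 P).rank ≤ 2 * max 2 (n - 1) := by
  obtain ⟨s, f, g, hs, hf, hg, hPfg⟩ := exists_eq_sum_mul_of_isAffineDetRepr hA hP
  rw [hPfg]
  exact (rank_hess0_sum_mul_le s (fun i => (hf i).2) fun i => (hg i).2).trans
    (Nat.mul_le_mul_left 2 hs)

/-- Lemma 2.1, first printed clause: `n = 2 ⇒ r ≤ 4`. [cite: MignonRessayre2004, Lemma 2.1 (preprint p. 4)] -/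
theorem mignonRessayre2004_lemma_2_1_two {k : Type*} [Field k] {σ : Type*} [Fintype σ]
    {P : MvPolynomial σ k} {A : Matrix (Fin 2) (Fin 2) (MvPolynomial σ k)}
    (hA : IsAffineDetRepr P A) (hP : P.IsHomogeneous 2) : (hess0 P).rank ≤ 4 := by
  simpa using mignonRessayre2004_lemma_2_1 hA hP

/-- Lemma 2.1, second printed clause: `n ≥ 3 ⇒ r ≤ 2(n - 1)`. [cite: MignonRessayre2004, Lemma 2.1 (preprint p. 4)] -/
theorem mignonRessayre2004_lemma_2_1_three_le {k : Type*} [Field k] {σ : Type*} [Fintype σ]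
    {n : ℕ} (hn : 3 ≤ n) {P : MvPolynomial σ k} {A : Matrix (Fin n) (Fin n) (MvPolynomial σ k)}
    (hA : IsAffineDetRepr P A) (hP : P.IsHomogeneous 2) : (hess0 P).rank ≤ 2 * (n - 1) := by
  have h := mignonRessayre2004_lemma_2_1 hA hP
  rwa [max_eq_right (by omega)] at h

/-- **Mignon–Ressayre 2004, Theorem 1, lower half** (preprint p. 5 L197: "We may now assume that
`r ≥ 5`. Then, Lemma 2.1 shows that `𝒟c(P) ≥ r/2 + 1`"), for every quadratic form `P` over every
field, with `r = rank H₀(P)`: if `r ≥ 5` then `2 · dc(P) ≥ r + 2`, i.e. `dc(P) ≥ ⌈r/2⌉ + 1`.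
(`dc = determinantalComplexity`, attained by `hasDetRepr_determinantalComplexity_holds`.)
[cite: MignonRessayre2004, Theorem 1 (preprint §2, p. 4 L147–151)] -/
theorem mignonRessayre2004_thm_1_lower {k : Type*} [Field k] {σ : Type*} [Fintype σ]
    {P : MvPolynomial σ k} (hP : P.IsHomogeneous 2) (hr : 5 ≤ (hess0 P).rank) :
    (hess0 P).rank + 2 ≤ 2 * determinantalComplexity P := by
  obtain ⟨A, hA⟩ := hasDetRepr_determinantalComplexity_holds P
  have h := mignonRessayre2004_lemma_2_1 hA hP
  rcases le_total 2 (determinantalComplexity P - 1) with h2 | h2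
  · rw [max_eq_right h2] at h
    omega
  · rw [max_eq_left h2] at h
    omega


/-! ### The upper half of Theorem 1: bordered matrices -/

namespace MR04Quadric

variable {k : Type*} [Field k] {σ : Type*}

/-- **The bordered matrix of the proof of Theorem 1** (preprint p. 5: the `(d+1) × (d+1)` matrix
`[[0, x₁, …, x_d], [-y₁, 1, 0, …], …, [-y_d, 0, …, 1]]` with determinant `Σ xᵢ yᵢ`): for affine
`u, v : ι → k[x]`, `Σ_i uᵢ vᵢ = det [[I_ι, v], [-uᵀ, 0]]` (Schur complement), an affine
determinantal representation of size `|ι| + 1` (cf. `LR17Quadric.det_fromBlocks_eq` in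
`LR17EquivariantQuadricProofs.lean`, the symmetric case `xᵀ S x`; here the two vectors of linear
forms are independent). [cite: MignonRessayre2004, Theorem 1 (preprint p. 5, proof)] -/
theorem hasDetRepr_sum_mul {ι : Type*} [Fintype ι] [DecidableEq ι] (u v : ι → MvPolynomial σ k)
    (hu : ∀ i, (u i).totalDegree ≤ 1) (hv : ∀ i, (v i).totalDegree ≤ 1) :
    HasDetRepr (∑ i, u i * v i) (Fintype.card ι + 1) := by
  classical
  let e : ι ⊕ Fin 1 ≃ Fin (Fintype.card ι + 1) :=
    (Equiv.sumCongr (Fintype.equivFin ι) (Equiv.refl _)).trans finSumFinEquiv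
  let N : Matrix (ι ⊕ Fin 1) (ι ⊕ Fin 1) (MvPolynomial σ k) :=
    Matrix.fromBlocks 1 (Matrix.replicateCol (Fin 1) v) (-Matrix.replicateRow (Fin 1) u) 0
  refine ⟨Matrix.reindex e e N, fun i j => ?_, ?_⟩
  · rw [Matrix.reindex_apply, Matrix.submatrix_apply]
    rcases e.symm i with a | a <;> rcases e.symm j with b | b
    · simp only [N, Matrix.fromBlocks_apply₁₁, Matrix.one_apply]
      split_ifs
      · rw [totalDegree_one]; exact zero_le_one
      · rw [totalDegree_zero]; exact zero_le_one
    · simp only [N, Matrix.fromBlocks_apply₁₂, Matrix.replicateCol_apply]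
      exact hv a
    · simp only [N, Matrix.fromBlocks_apply₂₁, Matrix.neg_apply, Matrix.replicateRow_apply,
        totalDegree_neg]
      exact hu b
    · simp only [N, Matrix.fromBlocks_apply₂₂, Matrix.zero_apply, totalDegree_zero]
      exact zero_le_one
  · rw [Matrix.det_reindex_self, Matrix.det_fromBlocks_one₁₁, Matrix.neg_mul, zero_sub, neg_neg,
      Matrix.det_unique, Matrix.replicateRow_mul_replicateCol_apply]
    rfl

/-- `dc(Σ_{i ∈ ι} uᵢ vᵢ) ≤ |ι| + 1` for affine `uᵢ, vᵢ` (preprint p. 5–6: "So, `𝒟c(P) ≤ r/2 + 1`",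
"`𝒟c(P) ≤ d + 2`"). [cite: MignonRessayre2004, Theorem 1 (preprint p. 5, proof)] -/
theorem determinantalComplexity_sum_mul_le {ι : Type*} [Fintype ι] [DecidableEq ι]
    (u v : ι → MvPolynomial σ k) (hu : ∀ i, (u i).totalDegree ≤ 1)
    (hv : ∀ i, (v i).totalDegree ≤ 1) :
    determinantalComplexity (∑ i, u i * v i) ≤ Fintype.card ι + 1 :=
  determinantalComplexity_le_of_hasDetRepr (hasDetRepr_sum_mul u v hu hv)

end MR04Quadric

/-! ### The split normal forms and their Hessians -/

/-- The **split quadratic form of rank `2d`**, `q_{2d} = Σ_{i<d} xᵢ yᵢ` in the `2d` variables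
`Fin d ⊕ Fin d` (`xᵢ = X (inl i)`, `yᵢ = X (inr i)`). Over an algebraically closed field of
characteristic `≠ 2` every quadratic form of rank `2d` is linearly equivalent to it (preprint p. 5
L25: "`P = φ₁φ₂ + φ₃φ₄ + ⋯`"). [cite: MignonRessayre2004, §2 (preprint p. 5)] -/
def splitQuadric (k : Type*) [CommRing k] (d : ℕ) : MvPolynomial (Fin d ⊕ Fin d) k :=
  ∑ i : Fin d, X (Sum.inl i) * X (Sum.inr i)

/-- The **split quadratic form of odd rank `2d + 1`**, `q_{2d+1} = Σ_{i<d} xᵢ yᵢ + z²` in the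
variables `Option (Fin d ⊕ Fin d)` (`z = X none`). [cite: MignonRessayre2004, §2 (preprint p. 5)] -/
def splitQuadricOdd (k : Type*) [CommRing k] (d : ℕ) : MvPolynomial (Option (Fin d ⊕ Fin d)) k :=
  ∑ i : Fin d, X (some (Sum.inl i)) * X (some (Sum.inr i)) + X none * X none

namespace MR04Quadric

variable {k : Type*} [Field k] {σ : Type*}

/-- `q_{2d}` is a quadratic form (homogeneous of degree `2`). [cite: MignonRessayre2004, Theorem 1 (preprint §2, p. 5, proof)] -/
theorem splitQuadric_isHomogeneous (d : ℕ) : (splitQuadric k d).IsHomogeneous 2 :=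
  IsHomogeneous.sum _ _ _ fun i _ => (isHomogeneous_X k (Sum.inl i)).mul (isHomogeneous_X k _)

/-- `q_{2d+1}` is a quadratic form (homogeneous of degree `2`). [cite: MignonRessayre2004, Theorem 1 (preprint §2, p. 5, proof)] -/
theorem splitQuadricOdd_isHomogeneous (d : ℕ) : (splitQuadricOdd k d).IsHomogeneous 2 :=
  (IsHomogeneous.sum _ _ _ fun i _ =>
    (isHomogeneous_X k (some (Sum.inl i))).mul (isHomogeneous_X k _)).add
    ((isHomogeneous_X k _).mul (isHomogeneous_X k _))

/-- The linear part of a variable is the corresponding unit vector. [folklore] -/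
private theorem linPart_X [DecidableEq σ] (s a : σ) :
    linPart (X s : MvPolynomial σ k) a = if a = s then 1 else 0 := by
  rw [linPart_apply, pderiv_X, Pi.single_apply]
  by_cases h : a = s
  · subst h
    simp
  · rw [if_neg (Ne.symm h), if_neg h, map_zero]

/-- `H₀(X_s X_t)_{ab} = [a = s][b = t] + [a = t][b = s]`. [folklore] -/
private theorem hess0_X_mul_X_apply [DecidableEq σ] (s t a b : σ) :
    hess0 (X s * X t : MvPolynomial σ k) a b =
      (if a = s then 1 else 0) * (if b = t then 1 else 0) +
        (if a = t then 1 else 0) * (if b = s then 1 else 0) := by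
  rw [hess0_mul, constantCoeff_X, constantCoeff_X, zero_smul, zero_smul, zero_add, zero_add,
    Matrix.add_apply, vecMulVec_apply, vecMulVec_apply, linPart_X, linPart_X, linPart_X, linPart_X]

/-- The Hessian of `q_{2d}` is the permutation matrix of `xᵢ ↔ yᵢ`. [folklore] -/
private theorem hess0_splitQuadric_apply (d : ℕ) (a b : Fin d ⊕ Fin d) :
    hess0 (splitQuadric k d) a b = if b = Sum.swap a then 1 else 0 := by
  classical
  simp only [splitQuadric, map_sum, Matrix.sum_apply, hess0_X_mul_X_apply]
  rcases a with j | j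
  · rw [Sum.swap_inl, Finset.sum_eq_single j]
    · simp
    · intro i _ hij
      simp [Ne.symm hij]
    · simp
  · rw [Sum.swap_inr, Finset.sum_eq_single j]
    · simp
    · intro i _ hij
      simp [Ne.symm hij]
    · simp

/-- The Hessian of `q_{2d+1}`: the permutation matrix of `xᵢ ↔ yᵢ` bordered by the entry `2` at
`(z, z)`. [folklore] -/
private theorem hess0_splitQuadricOdd_apply (d : ℕ) (a b : Option (Fin d ⊕ Fin d)) :
    hess0 (splitQuadricOdd k d) a b =
      if b = Option.map Sum.swap a then (if a = none then 2 else 1) else 0 := by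
  classical
  simp only [splitQuadricOdd, map_add, map_sum, Matrix.add_apply, Matrix.sum_apply,
    hess0_X_mul_X_apply]
  rcases a with _ | j | j
  · simp only [Option.map_none, if_true]   -- hmm
    simp
    split_ifs <;> norm_num
  · rw [Option.map_some, Sum.swap_inl, Finset.sum_eq_single j]
    · simp
    · intro i _ hij
      simp [Ne.symm hij]
    · simp
  · rw [Option.map_some, Sum.swap_inr, Finset.sum_eq_single j]
    · simp
    · intro i _ hij
      simp [Ne.symm hij]
    · simp

/-- `H₀(q_{2d})² = 1`. [folklore] -/
private theorem hess0_splitQuadric_mul_self (d : ℕ) :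
    hess0 (splitQuadric k d) * hess0 (splitQuadric k d) = 1 := by
  classical
  ext a c
  rw [Matrix.mul_apply, Finset.sum_eq_single (Sum.swap a)]
  · rw [hess0_splitQuadric_apply, hess0_splitQuadric_apply, if_pos rfl, one_mul, Sum.swap_swap,
      Matrix.one_apply]
    by_cases hac : a = c
    · rw [if_pos hac, if_pos hac.symm]
    · rw [if_neg hac, if_neg (Ne.symm hac)]
  · intro b _ hb
    rw [hess0_splitQuadric_apply, if_neg hb, zero_mul]
  · intro h
    exact absurd (Finset.mem_univ _) h

/-- `rank H₀(q_{2d}) = 2d` over every field: the split form `Σ_{i<d} xᵢyᵢ` has rank `r = 2d`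
(preprint p. 5: "Let us assume that `r = 2d` is even … `P = φ₁φ₂ + φ₃φ₄ + ⋯`").
[cite: MignonRessayre2004, Theorem 1 (preprint §2, p. 5, proof)] -/
theorem rank_hess0_splitQuadric (d : ℕ) : (hess0 (splitQuadric k d)).rank = 2 * d := by
  classical
  rw [Matrix.rank_of_isUnit _ ((Matrix.isUnit_iff_isUnit_det _).2
    (Matrix.isUnit_det_of_right_inverse (hess0_splitQuadric_mul_self (k := k) d))),
    Fintype.card_sum, Fintype.card_fin]
  ring

/-- An explicit inverse of `H₀(q_{2d+1})` when `2` is invertible. [folklore] -/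
private theorem hess0_splitQuadricOdd_mul (d : ℕ) (h2 : (2 : k) ≠ 0) :
    hess0 (splitQuadricOdd k d) *
        (Matrix.of fun a b : Option (Fin d ⊕ Fin d) =>
          if b = Option.map Sum.swap a then (if a = none then (2 : k)⁻¹ else 1) else 0) = 1 := by
  classical
  ext a c
  rw [Matrix.mul_apply, Finset.sum_eq_single (Option.map Sum.swap a)]
  · rw [hess0_splitQuadricOdd_apply, if_pos rfl, Matrix.of_apply, Matrix.one_apply]
    rcases a with _ | x
    · simp only [Option.map_none, if_true]
      by_cases hc : c = none
      · subst hc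
        simp [h2]
      · rw [if_neg hc, if_neg (Ne.symm hc), mul_zero]
    · simp only [Option.map_some, Sum.swap_swap, reduceCtorEq, if_false, one_mul]
      by_cases hc : some x = c
      · rw [if_pos hc, if_pos hc.symm]
      · rw [if_neg hc, if_neg (Ne.symm hc)]
  · intro b _ hb
    rw [hess0_splitQuadricOdd_apply, if_neg hb, zero_mul]
  · intro h
    exact absurd (Finset.mem_univ _) h

/-- `rank H₀(q_{2d+1}) = 2d + 1` when `2 ≠ 0` in `k`: the split form `Σ_{i<d} xᵢyᵢ + z²` has
rank `r = 2d + 1` (preprint p. 6: the case "`r = 2d + 1` is odd").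
[cite: MignonRessayre2004, Theorem 1 (preprint §2, p. 6, proof)] -/
theorem rank_hess0_splitQuadricOdd (d : ℕ) (h2 : (2 : k) ≠ 0) :
    (hess0 (splitQuadricOdd k d)).rank = 2 * d + 1 := by
  classical
  rw [Matrix.rank_of_isUnit _ ((Matrix.isUnit_iff_isUnit_det _).2
    (Matrix.isUnit_det_of_right_inverse (hess0_splitQuadricOdd_mul (k := k) d h2))),
    Fintype.card_option, Fintype.card_sum, Fintype.card_fin]
  ring

/-- `q_{2d} ≠ 0` for `d ≥ 1`. [folklore] -/
private theorem splitQuadric_ne_zero {d : ℕ} (hd : 1 ≤ d) : splitQuadric k d ≠ 0 := by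
  intro h
  have hr := rank_hess0_splitQuadric (k := k) d
  rw [h, map_zero, Matrix.rank_zero] at hr
  omega

/-- `q_{2d+1} ≠ 0`. [folklore] -/
private theorem splitQuadricOdd_ne_zero (d : ℕ) : splitQuadricOdd k d ≠ 0 := by
  classical
  intro h
  have := congrArg (eval fun v : Option (Fin d ⊕ Fin d) => if v = none then (1 : k) else 0) h
  simp [splitQuadricOdd, eval_X] at this

/-- `dc(q_{2d}) ≥ 2` for `d ≥ 1`: the degree bound `𝒟c(P) ≥ deg P = 2` of the proof of Theorem 1
(preprint p. 5 L191: "Since the degree of `P` is two, `𝒟c(P) ≥ 2`"; `totalDegree_le_determinantalComplexity`).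
[cite: MignonRessayre2004, Theorem 1 (preprint §2, p. 5, proof)] -/
theorem two_le_determinantalComplexity_splitQuadric {d : ℕ} (hd : 1 ≤ d) :
    2 ≤ determinantalComplexity (splitQuadric k d) := by
  have h := totalDegree_le_determinantalComplexity_holds (splitQuadric k d)
  rwa [(splitQuadric_isHomogeneous (k := k) d).totalDegree (splitQuadric_ne_zero hd)] at h

/-- `dc(q_{2d+1}) ≥ 2`: the degree bound `𝒟c(P) ≥ deg P = 2` of the proof of Theorem 1
(preprint p. 5 L191). [cite: MignonRessayre2004, Theorem 1 (preprint §2, p. 5, proof)] -/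
theorem two_le_determinantalComplexity_splitQuadricOdd (d : ℕ) :
    2 ≤ determinantalComplexity (splitQuadricOdd k d) := by
  have h := totalDegree_le_determinantalComplexity_holds (splitQuadricOdd k d)
  rwa [(splitQuadricOdd_isHomogeneous (k := k) d).totalDegree (splitQuadricOdd_ne_zero d)] at h

/-- Upper bound `dc(q_{2d}) ≤ d + 1` by the bordered matrix. [cite: MignonRessayre2004, Theorem 1 (preprint p. 5, proof)] -/
theorem determinantalComplexity_splitQuadric_le (d : ℕ) :
    determinantalComplexity (splitQuadric k d) ≤ d + 1 := by
  classical
  have h := determinantalComplexity_sum_mul_le (σ := Fin d ⊕ Fin d) (k := k)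
    (fun i : Fin d => X (Sum.inl i)) (fun i => X (Sum.inr i))
    (fun i => (totalDegree_X (R := k) _).le) (fun i => (totalDegree_X (R := k) _).le)
  rwa [Fintype.card_fin] at h

/-- Upper bound `dc(q_{2d+1}) ≤ d + 2` by the bordered matrix (with the pair `(z, z)` added).
[cite: MignonRessayre2004, Theorem 1 (preprint p. 6, proof)] -/
theorem determinantalComplexity_splitQuadricOdd_le (d : ℕ) :
    determinantalComplexity (splitQuadricOdd k d) ≤ d + 2 := by
  classical
  have h := determinantalComplexity_sum_mul_le (σ := Option (Fin d ⊕ Fin d)) (k := k)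
    (fun o : Option (Fin d) => X (Option.map Sum.inl o)) (fun o => X (Option.map Sum.inr o))
    (fun i => (totalDegree_X (R := k) _).le) (fun i => (totalDegree_X (R := k) _).le)
  have hq : splitQuadricOdd k d =
      ∑ o : Option (Fin d), X (Option.map Sum.inl o) * X (Option.map Sum.inr o) := by
    rw [splitQuadricOdd, Fintype.sum_option, add_comm]
    rfl
  rw [Fintype.card_option, Fintype.card_fin] at h
  rw [hq]
  exact h.trans le_rfl

end MR04Quadric

open MR04Quadric

/-! ### Theorem 1 -/

/-- **Mignon–Ressayre 2004, Theorem 1, even rank `r = 2d ≥ 6`** (preprint §2, p. 4 L147–151: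
"Let `P` be a non zero quadratic form on `V`. Let `r` denote the rank of `P`. Then
`𝒟c(P) = 2` if `r ≤ 4`; `⌈r/2⌉ + 1` else"; `k` algebraically closed there), on the split normal
form and over EVERY field: `dc(Σ_{i<d} xᵢ yᵢ) = d + 1` for `d ≥ 3`. (The INTRODUCTION of the
preprint, p. 2 L62–69, prints `⌈(r+1)/2⌉` instead, which disagrees with the §2 statement and with
the proof for odd `r`; Alper–Bogart–Velasco 2017, p. 3, quote "`⌈(r+1)/2⌉` for `r ≥ 4` and `2`
otherwise [MR04, Thm 1.4]", which is false at `r = 4` — see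
`determinantalComplexity_splitQuadric_two`.) Over an algebraically closed field of characteristic
`≠ 2` every quadratic form of rank `2d` is `GL`-equivalent to the split form, and `dc` and `r` are
invariant, so this is the printed statement for even `r ≥ 6`.
-- TODO(general form): the reduction of an arbitrary quadratic form to `splitQuadric` /
-- `splitQuadricOdd` (Mathlib `QuadraticForm.equivalent_weightedSumSquares`) is not threaded here.
[cite: MignonRessayre2004, Theorem 1 (preprint §2, p. 4 L147–151)] -/
theorem mignonRessayre2004_thm_1_even {k : Type*} [Field k] {d : ℕ} (hd : 3 ≤ d) :
    determinantalComplexity (splitQuadric k d) = d + 1 := by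
  refine le_antisymm (determinantalComplexity_splitQuadric_le d) ?_
  have h := mignonRessayre2004_thm_1_lower (splitQuadric_isHomogeneous (k := k) d)
    (by rw [rank_hess0_splitQuadric]; omega)
  rw [rank_hess0_splitQuadric] at h
  omega

/-- **Mignon–Ressayre 2004, Theorem 1, odd rank `r = 2d + 1 ≥ 5`**: over every field with
`2 ≠ 0`, `dc(Σ_{i<d} xᵢ yᵢ + z²) = d + 2 = ⌈r/2⌉ + 1` for `d ≥ 2` (preprint p. 6 L12: "So,
`𝒟c(P) ≤ d + 2 = ⌈r/2 + 1⌉`", lower bound by Lemma 2.1).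
[cite: MignonRessayre2004, Theorem 1 (preprint §2, p. 4 L147–151)] -/
theorem mignonRessayre2004_thm_1_odd {k : Type*} [Field k] {d : ℕ} (hd : 2 ≤ d)
    (h2 : (2 : k) ≠ 0) : determinantalComplexity (splitQuadricOdd k d) = d + 2 := by
  refine le_antisymm (determinantalComplexity_splitQuadricOdd_le d) ?_
  have h := mignonRessayre2004_thm_1_lower (splitQuadricOdd_isHomogeneous (k := k) d)
    (by rw [rank_hess0_splitQuadricOdd d h2]; omega)
  rw [rank_hess0_splitQuadricOdd d h2] at h
  omega

/-- **Theorem 1, rank `1`**: `dc(z²) = 2`. [cite: MignonRessayre2004, Theorem 1 (preprint §2, p. 4 L147–151)] -/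
theorem determinantalComplexity_splitQuadricOdd_zero {k : Type*} [Field k] :
    determinantalComplexity (splitQuadricOdd k 0) = 2 :=
  le_antisymm (determinantalComplexity_splitQuadricOdd_le 0)
    (two_le_determinantalComplexity_splitQuadricOdd 0)

/-- **Theorem 1, rank `2`**: `dc(x y) = 2`. [cite: MignonRessayre2004, Theorem 1 (preprint §2, p. 4 L147–151)] -/
theorem determinantalComplexity_splitQuadric_one {k : Type*} [Field k] :
    determinantalComplexity (splitQuadric k 1) = 2 :=
  le_antisymm (determinantalComplexity_splitQuadric_le 1)
    (two_le_determinantalComplexity_splitQuadric le_rfl)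

/-- **Theorem 1, rank `3`**: `dc(x y + z²) = 2`, by `x y + z² = det [[x, z], [-z, y]]`.
[cite: MignonRessayre2004, Theorem 1 (preprint §2, p. 4 L147–151)] -/
theorem determinantalComplexity_splitQuadricOdd_one {k : Type*} [Field k] :
    determinantalComplexity (splitQuadricOdd k 1) = 2 := by
  refine le_antisymm (determinantalComplexity_le_of_hasDetRepr ?_)
    (two_le_determinantalComplexity_splitQuadricOdd 1)
  refine ⟨!![X (some (Sum.inl 0)), X none; -X none, X (some (Sum.inr 0))], fun i j => ?_, ?_⟩
  · fin_cases i <;> fin_cases j <;> simp [totalDegree_neg]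
  · rw [Matrix.det_fin_two_of, splitQuadricOdd, Fin.sum_univ_one]
    ring

/-- **Theorem 1, rank `4`**: `dc(x₁ y₁ + x₂ y₂) = 2`, by `x₁ y₁ + x₂ y₂ = det [[x₁, x₂], [-y₂, y₁]]`
— the value the ABV quote "`⌈(r+1)/2⌉` for `r ≥ 4`" gets wrong.
[cite: MignonRessayre2004, Theorem 1 (preprint §2, p. 4 L147–151)] -/
theorem determinantalComplexity_splitQuadric_two {k : Type*} [Field k] :
    determinantalComplexity (splitQuadric k 2) = 2 := by
  refine le_antisymm (determinantalComplexity_le_of_hasDetRepr ?_)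
    (two_le_determinantalComplexity_splitQuadric (by norm_num))
  refine ⟨!![X (Sum.inl 0), X (Sum.inl 1); -X (Sum.inr 1), X (Sum.inr 0)], fun i j => ?_, ?_⟩
  · fin_cases i <;> fin_cases j <;> simp [totalDegree_neg]
  · rw [Matrix.det_fin_two_of, splitQuadric, Fin.sum_univ_two]
    ring

end Literature.Computability.AlgebraicComplexity
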